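import Summits.AtomisticToContinuum.HydrodynamicLimit.Theorems.EnskogAdjointDualityDualityReductionLBound
import Summits.AtomisticToContinuum.HydrodynamicLimit.Theorems.EnskogAdjointDualityDualityReductionLMeasurable
import Summits.AtomisticToContinuum.HydrodynamicLimit.Theorems.EnskogAdjointDualityDualityReductionProfiles
import HarnessLib

/-!
# Defect split for the K2R Enskog defect, part 2: the collision bracket is a genuine double
# integral, linear in the test function

Route `EnskogAdjointDuality` of `AtomisticToContinuum/HydrodynamicLimit`, crux K2R
`AdjointEnskogTestFamilyR` (stmt-AtomisticToContinuum-11592), line `birth`, stub G1 `stub_defectSplit`.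

At a fixed time, the test-side Enskog bracket of the route,
`E[φ](x, v) = ∫_{S²} ∫ ((v−w)·ω)₊ Y(x_ω) ρ(y_ω) M_{1,θ(y_ω),u(y_ω)}(w) [φ(x,v') + φ(y_ω,w') − φ(x,v) − φ(y_ω,w)] dw dσ(ω)`,
is, for continuous bounded profiles (`0 ≤ ρ ≤ R`, `0 < θ ≤ Θ`, `‖u‖ ≤ U`, `|Y| ≤ Ȳ`) and a jointly
continuous test function of quadratic growth, an absolutely convergent iterated integral:

* `k2r_bracket_inner` — the `w`-integrand is integrable (Gaussian moment domination), with the bound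
  `|∫ dw| ≤ Ȳ R (18 C_φ) C_G (1+|v|²)²`;
* `k2r_bracket_outer` — the `ω`-integrand `ω ↦ ∫ dw` is integrable for the finite sphere measure
  (joint continuity in `(ω, w)`, `StronglyMeasurable.integral_prod_right'`);
* `k2r_bracket_linear` — consequently `E[φ₁ + b φ₂] = E[φ₁] + b E[φ₂]`;
* `k2r_measurable_enskogL_frozen`, `k2r_enskogL_split` — along a time window `[0, t]`: measurability
  of the time-frozen operator, and the split `λE[ψ + κ/λ] = λE[ψ] + E[κ]` used by the defect split
  (registered sub-goal `stub_defectSplit_bracket`).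

References: M. Pulvirenti, S. Simonella, arXiv:1504.03215, §2 [PulvirentiSimonella2016]; folklore.
-/

noncomputable section

open MeasureTheory Metric Set Filter Topology Function
open scoped InnerProductSpace ENNReal

namespace Summit.AtomisticToContinuum.HydrodynamicLimit.Theorems.EnskogAdjointDuality

open Literature.Analysis.FluidPDE Literature.MathematicalPhysics.KineticTheory
open Literature.MathematicalPhysics.QuantumLattice (clamp_mem_Icc)

section Bracket

variable {ρ₀ θ₀ Y₀ : T3 → ℝ} {u₀ : T3 → V3} {R Θ U Yb CG : ℝ}

/-- Pointwise Gaussian domination of the bracket integrand: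
`|q₊ Y(x') ρ(y) M_y(w) Δφ| ≤ M_y(w) · |Ȳ| |R| (18|C_φ|) (1+|v|²)² (1+|w|²)²`. [folklore] -/
theorem k2r_bracket_dom (hρb : ∀ y, 0 ≤ ρ₀ y ∧ ρ₀ y ≤ R) (hθb : ∀ y, 0 < θ₀ y ∧ θ₀ y ≤ Θ)
    (hYb : ∀ y, |Y₀ y| ≤ Yb) {φ : T3 → V3 → ℝ} {Cφ : ℝ} (hφb : ∀ y v, |φ y v| ≤ Cφ * (1 + ‖v‖ ^ 2))
    (x' y x : T3) (v w : V3) (ω : sphere (0 : V3) 1) :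
    ‖max ⟪v - w, (ω : V3)⟫_ℝ 0 * Y₀ x' * (ρ₀ y * localMaxwellian 1 (θ₀ y) (u₀ y) w) *
        (φ x (v - ⟪v - w, (ω : V3)⟫_ℝ • (ω : V3)) + φ y (w + ⟪v - w, (ω : V3)⟫_ℝ • (ω : V3)) -
          φ x v - φ y w)‖ ≤
      localMaxwellian 1 (θ₀ y) (u₀ y) w *
        (|Yb| * |R| * (18 * |Cφ|) * (1 + ‖v‖ ^ 2) ^ 2 * (1 + ‖w‖ ^ 2) ^ 2) := by
  have hθy := hθb y
  have hgy := hρb y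
  have hω : ‖(ω : V3)‖ = 1 := norm_eq_of_mem_sphere ω
  have hφ' : ∀ x'' v', |φ x'' v'| ≤ |Cφ| * (1 + ‖v'‖ ^ 2) := fun x'' v' =>
    (hφb x'' v').trans (mul_le_mul_of_nonneg_right (le_abs_self _) (by positivity))
  have hM0 : 0 ≤ localMaxwellian 1 (θ₀ y) (u₀ y) w := localMaxwellian_nonneg zero_le_one hθy.1.le _ _
  have hmax : |max ⟪v - w, (ω : V3)⟫_ℝ 0| ≤ (1 + ‖v‖ ^ 2) * (1 + ‖w‖ ^ 2) := by
    have h1 : |max ⟪v - w, (ω : V3)⟫_ℝ 0| ≤ ‖v - w‖ := by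
      rw [abs_of_nonneg (le_max_right _ _)]
      refine max_le ?_ (norm_nonneg _)
      have := abs_real_inner_le_norm (v - w) (ω : V3)
      rw [hω, mul_one] at this
      exact (le_abs_self _).trans this
    have h2 : ‖v - w‖ ≤ ‖v‖ + ‖w‖ := norm_sub_le v w
    have hv1 : ‖v‖ ≤ (1 + ‖v‖ ^ 2) / 2 := by nlinarith [sq_nonneg (‖v‖ - 1)]
    have hw1 : ‖w‖ ≤ (1 + ‖w‖ ^ 2) / 2 := by nlinarith [sq_nonneg (‖w‖ - 1)]
    have hprod : (1 + ‖v‖ ^ 2) / 2 + (1 + ‖w‖ ^ 2) / 2 ≤ (1 + ‖v‖ ^ 2) * (1 + ‖w‖ ^ 2) := by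
      nlinarith [sq_nonneg ‖v‖, sq_nonneg ‖w‖, mul_nonneg (sq_nonneg ‖v‖) (sq_nonneg ‖w‖)]
    linarith
  have hinc := abs_increment_le (φ := φ) hφ' x y v w ω
  have hYb' : |Y₀ x'| ≤ |Yb| := (hYb x').trans (le_abs_self _)
  have hgb : |ρ₀ y| ≤ |R| := by rw [abs_of_nonneg hgy.1]; exact hgy.2.trans (le_abs_self _)
  rw [Real.norm_eq_abs, abs_mul, abs_mul, abs_mul, abs_mul, abs_of_nonneg hM0]
  calc |max ⟪v - w, (ω : V3)⟫_ℝ 0| * |Y₀ x'| * (|ρ₀ y| * localMaxwellian 1 (θ₀ y) (u₀ y) w) *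
        |φ x (v - ⟪v - w, (ω : V3)⟫_ℝ • (ω : V3)) + φ y (w + ⟪v - w, (ω : V3)⟫_ℝ • (ω : V3)) -
          φ x v - φ y w|
      ≤ ((1 + ‖v‖ ^ 2) * (1 + ‖w‖ ^ 2)) * |Yb| * (|R| * localMaxwellian 1 (θ₀ y) (u₀ y) w) *
        (18 * |Cφ| * ((1 + ‖v‖ ^ 2) * (1 + ‖w‖ ^ 2))) := by
        gcongr
    _ = _ := by ring

/-- **The `w`-integral of the bracket.** For bounded profiles and a test function of quadratic growth,
continuous in `v`, the `w`-integrand of the bracket at `(x', y, x, v, ω)` is integrable on `ℝ³` and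
`|∫ dw| ≤ |Ȳ| |R| (18|C_φ|) C_G (1+|v|²)²`, `C_G` a uniform bound of `∫ (1+|w|²)² dN(u, θ)` on the
profile range. [cite: PulvirentiSimonella2016, §2] -/
theorem k2r_bracket_inner (hρb : ∀ y, 0 ≤ ρ₀ y ∧ ρ₀ y ≤ R) (hθb : ∀ y, 0 < θ₀ y ∧ θ₀ y ≤ Θ)
    (hub : ∀ y, ‖u₀ y‖ ≤ U) (hYb : ∀ y, |Y₀ y| ≤ Yb) {φ : T3 → V3 → ℝ} (hφc : ∀ y, Continuous (φ y))
    {Cφ : ℝ} (hφb : ∀ y v, |φ y v| ≤ Cφ * (1 + ‖v‖ ^ 2))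
    (hCG : ∀ (u' : V3) (θ' : ℝ), ‖u'‖ ≤ U → 0 < θ' → θ' ≤ Θ →
      ∫ v, (1 + ‖v‖ ^ 2) ^ 2 ∂gaussMeasure u' θ' ≤ CG)
    (x' y x : T3) (v : V3) (ω : sphere (0 : V3) 1) :
    Integrable (fun w : V3 => max ⟪v - w, (ω : V3)⟫_ℝ 0 * Y₀ x' *
        (ρ₀ y * localMaxwellian 1 (θ₀ y) (u₀ y) w) *
        (φ x (v - ⟪v - w, (ω : V3)⟫_ℝ • (ω : V3)) + φ y (w + ⟪v - w, (ω : V3)⟫_ℝ • (ω : V3)) -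
          φ x v - φ y w)) ∧
    |∫ w : V3, max ⟪v - w, (ω : V3)⟫_ℝ 0 * Y₀ x' * (ρ₀ y * localMaxwellian 1 (θ₀ y) (u₀ y) w) *
        (φ x (v - ⟪v - w, (ω : V3)⟫_ℝ • (ω : V3)) + φ y (w + ⟪v - w, (ω : V3)⟫_ℝ • (ω : V3)) -
          φ x v - φ y w)| ≤
      |Yb| * |R| * (18 * |Cφ|) * CG * (1 + ‖v‖ ^ 2) ^ 2 := by
  have hθy := hθb y
  have hint : Integrable (fun w : V3 => localMaxwellian 1 (θ₀ y) (u₀ y) w *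
      (|Yb| * |R| * (18 * |Cφ|) * (1 + ‖v‖ ^ 2) ^ 2 * (1 + ‖w‖ ^ 2) ^ 2)) := by
    rw [integrable_localMaxwellian_mul_iff hθy.1]
    exact (integrable_one_add_norm_sq_pow_gaussMeasure _ _ 2).const_mul _
  have hdom := fun w => k2r_bracket_dom (u₀ := u₀) hρb hθb hYb hφb x' y x v w ω
  have hin : Continuous fun w : V3 => ⟪v - w, (ω : V3)⟫_ℝ :=
    (continuous_const.sub continuous_id).inner continuous_const
  have hmeas : AEStronglyMeasurable (fun w : V3 => max ⟪v - w, (ω : V3)⟫_ℝ 0 * Y₀ x' *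
      (ρ₀ y * localMaxwellian 1 (θ₀ y) (u₀ y) w) *
      (φ x (v - ⟪v - w, (ω : V3)⟫_ℝ • (ω : V3)) + φ y (w + ⟪v - w, (ω : V3)⟫_ℝ • (ω : V3)) -
        φ x v - φ y w)) volume := by
    refine Continuous.aestronglyMeasurable ?_
    refine (((hin.max continuous_const).mul continuous_const).mul
      (continuous_const.mul (continuous_localMaxwellian 1 _ _))).mul ?_
    exact ((((hφc x).comp (continuous_const.sub (hin.smul continuous_const))).add
      ((hφc y).comp (continuous_id.add (hin.smul continuous_const)))).sub continuous_const).sub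
      (hφc y)
  refine ⟨hint.mono' hmeas (Eventually.of_forall hdom), ?_⟩
  have h := norm_integral_le_of_norm_le hint (Eventually.of_forall hdom)
  rw [Real.norm_eq_abs, integral_localMaxwellian_mul_eq_integral_gaussMeasure hθy.1,
    integral_const_mul] at h
  refine h.trans ?_
  have hCGy := hCG (u₀ y) (θ₀ y) (hub y) hθy.1 hθy.2
  have : 0 ≤ |Yb| * |R| * (18 * |Cφ|) * (1 + ‖v‖ ^ 2) ^ 2 := by positivity
  nlinarith

/-- **The `ω`-integral of the bracket.** For continuous bounded profiles, a jointly continuous test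
function of quadratic growth and continuous contact/partner maps `ω ↦ x_ω, y_ω`, the map
`ω ↦ ∫ ((v−w)·ω)₊ Y(x_ω) ρ(y_ω) M_{y_ω}(w) Δφ dw` is integrable for the (finite) sphere measure.
[cite: PulvirentiSimonella2016, §2] -/
theorem k2r_bracket_outer (hρc : Continuous ρ₀) (hθc : Continuous θ₀) (huc : Continuous u₀)
    (hYc : Continuous Y₀) (hρb : ∀ y, 0 ≤ ρ₀ y ∧ ρ₀ y ≤ R) (hθb : ∀ y, 0 < θ₀ y ∧ θ₀ y ≤ Θ)
    (hub : ∀ y, ‖u₀ y‖ ≤ U) (hYb : ∀ y, |Y₀ y| ≤ Yb) {φ : T3 → V3 → ℝ}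
    (hφc : Continuous (uncurry φ)) {Cφ : ℝ} (hφb : ∀ y v, |φ y v| ≤ Cφ * (1 + ‖v‖ ^ 2))
    (hCG : ∀ (u' : V3) (θ' : ℝ), ‖u'‖ ≤ U → 0 < θ' → θ' ≤ Θ →
      ∫ v, (1 + ‖v‖ ^ 2) ^ 2 ∂gaussMeasure u' θ' ≤ CG)
    {xs ys : sphere (0 : V3) 1 → T3} (hxs : Continuous xs) (hys : Continuous ys) (x : T3) (v : V3) :
    Integrable (fun ω : sphere (0 : V3) 1 => ∫ w : V3, max ⟪v - w, (ω : V3)⟫_ℝ 0 * Y₀ (xs ω) *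
        (ρ₀ (ys ω) * localMaxwellian 1 (θ₀ (ys ω)) (u₀ (ys ω)) w) *
        (φ x (v - ⟪v - w, (ω : V3)⟫_ℝ • (ω : V3)) + φ (ys ω) (w + ⟪v - w, (ω : V3)⟫_ℝ • (ω : V3)) -
          φ x v - φ (ys ω) w)) sphereMeasure := by
  haveI : IsFiniteMeasure (sphereMeasure : Measure (sphere (0 : V3) 1)) := by
    unfold sphereMeasure; infer_instance
  -- the integrand as a continuous function of `(ω, w)`
  set B : sphere (0 : V3) 1 × V3 → ℝ := fun q => max ⟪v - q.2, (q.1 : V3)⟫_ℝ 0 * Y₀ (xs q.1) *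
      (ρ₀ (ys q.1) * localMaxwellian 1 (θ₀ (ys q.1)) (u₀ (ys q.1)) q.2) *
      (φ x (v - ⟪v - q.2, (q.1 : V3)⟫_ℝ • (q.1 : V3)) +
        φ (ys q.1) (q.2 + ⟪v - q.2, (q.1 : V3)⟫_ℝ • (q.1 : V3)) - φ x v - φ (ys q.1) q.2) with hB
  have hw : Continuous fun q : sphere (0 : V3) 1 × V3 => q.2 := continuous_snd
  have hω : Continuous fun q : sphere (0 : V3) 1 × V3 => (q.1 : V3) := by fun_prop
  have hy : Continuous fun q : sphere (0 : V3) 1 × V3 => ys q.1 := hys.comp continuous_fst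
  have hx' : Continuous fun q : sphere (0 : V3) 1 × V3 => xs q.1 := hxs.comp continuous_fst
  have hin : Continuous fun q : sphere (0 : V3) 1 × V3 => ⟪v - q.2, (q.1 : V3)⟫_ℝ :=
    (continuous_const.sub hw).inner hω
  have hφ' : ∀ {a : sphere (0 : V3) 1 × V3 → T3} {b : sphere (0 : V3) 1 × V3 → V3},
      Continuous a → Continuous b → Continuous fun q => φ (a q) (b q) :=
    fun ha hb => hφc.comp (ha.prodMk hb)
  have hBc : Continuous B := by
    refine (((hin.max continuous_const).mul (hYc.comp hx')).mul
      ((hρc.comp hy).mul (continuous_localMaxwellian_param (hθc.comp hy) (fun q => (hθb _).1)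
        (huc.comp hy) hw))).mul ?_
    exact (((hφ' continuous_const (continuous_const.sub (hin.smul hω))).add
      (hφ' hy (hw.add (hin.smul hω)))).sub (hφ' continuous_const continuous_const)).sub (hφ' hy hw)
  have hsm : StronglyMeasurable fun ω : sphere (0 : V3) 1 => ∫ w, B (ω, w) :=
    hBc.stronglyMeasurable.integral_prod_right'
  refine (integrable_const (|Yb| * |R| * (18 * |Cφ|) * CG * (1 + ‖v‖ ^ 2) ^ 2)).mono'
    hsm.aestronglyMeasurable (Eventually.of_forall fun ω => ?_)
  rw [Real.norm_eq_abs]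
  exact (k2r_bracket_inner hρb hθb hub hYb (fun y => hφc.comp (Continuous.prodMk_right y)) hφb hCG
    (xs ω) (ys ω) x v ω).2

/-- **Linearity of the bracket in the test function.** With the data of `k2r_bracket_outer`, if
`φ = φ₁ + b φ₂` pointwise for jointly continuous `φ₁, φ₂` of quadratic growth, then
`E[φ](x, v) = E[φ₁](x, v) + b E[φ₂](x, v)` for the iterated bracket integral
`E[χ] = ∫_{S²} ∫ ((v−w)·ω)₊ Y(x_ω) ρ(y_ω) M_{y_ω}(w) [χ(x,v') + χ(y_ω,w') − χ(x,v) − χ(y_ω,w)] dw dσ(ω)`.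
[folklore] -/
theorem k2r_bracket_linear (hρc : Continuous ρ₀) (hθc : Continuous θ₀) (huc : Continuous u₀)
    (hYc : Continuous Y₀) (hρb : ∀ y, 0 ≤ ρ₀ y ∧ ρ₀ y ≤ R) (hθb : ∀ y, 0 < θ₀ y ∧ θ₀ y ≤ Θ)
    (hub : ∀ y, ‖u₀ y‖ ≤ U) (hYb : ∀ y, |Y₀ y| ≤ Yb)
    (hCG : ∀ (u' : V3) (θ' : ℝ), ‖u'‖ ≤ U → 0 < θ' → θ' ≤ Θ →
      ∫ v, (1 + ‖v‖ ^ 2) ^ 2 ∂gaussMeasure u' θ' ≤ CG)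
    {xs ys : sphere (0 : V3) 1 → T3} (hxs : Continuous xs) (hys : Continuous ys)
    {φ φ₁ φ₂ : T3 → V3 → ℝ} {b C₁ C₂ : ℝ} (hφ : ∀ y w, φ y w = φ₁ y w + b * φ₂ y w)
    (hφ₁c : Continuous (uncurry φ₁)) (hφ₂c : Continuous (uncurry φ₂))
    (hφ₁b : ∀ y w, |φ₁ y w| ≤ C₁ * (1 + ‖w‖ ^ 2)) (hφ₂b : ∀ y w, |φ₂ y w| ≤ C₂ * (1 + ‖w‖ ^ 2))
    (x : T3) (v : V3) :
    ∫ ω : sphere (0 : V3) 1, (∫ w : V3, max ⟪v - w, (ω : V3)⟫_ℝ 0 * Y₀ (xs ω) *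
        (ρ₀ (ys ω) * localMaxwellian 1 (θ₀ (ys ω)) (u₀ (ys ω)) w) *
        (φ x (v - ⟪v - w, (ω : V3)⟫_ℝ • (ω : V3)) + φ (ys ω) (w + ⟪v - w, (ω : V3)⟫_ℝ • (ω : V3)) -
          φ x v - φ (ys ω) w)) ∂sphereMeasure =
      (∫ ω : sphere (0 : V3) 1, (∫ w : V3, max ⟪v - w, (ω : V3)⟫_ℝ 0 * Y₀ (xs ω) *
        (ρ₀ (ys ω) * localMaxwellian 1 (θ₀ (ys ω)) (u₀ (ys ω)) w) *
        (φ₁ x (v - ⟪v - w, (ω : V3)⟫_ℝ • (ω : V3)) + φ₁ (ys ω) (w + ⟪v - w, (ω : V3)⟫_ℝ • (ω : V3)) -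
          φ₁ x v - φ₁ (ys ω) w)) ∂sphereMeasure) +
      b * ∫ ω : sphere (0 : V3) 1, (∫ w : V3, max ⟪v - w, (ω : V3)⟫_ℝ 0 * Y₀ (xs ω) *
        (ρ₀ (ys ω) * localMaxwellian 1 (θ₀ (ys ω)) (u₀ (ys ω)) w) *
        (φ₂ x (v - ⟪v - w, (ω : V3)⟫_ℝ • (ω : V3)) + φ₂ (ys ω) (w + ⟪v - w, (ω : V3)⟫_ℝ • (ω : V3)) -
          φ₂ x v - φ₂ (ys ω) w)) ∂sphereMeasure := by
  have h1c : ∀ y, Continuous (φ₁ y) := fun y => hφ₁c.comp (Continuous.prodMk_right y)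
  have h2c : ∀ y, Continuous (φ₂ y) := fun y => hφ₂c.comp (Continuous.prodMk_right y)
  -- the `w`-level
  have hinner : ∀ ω : sphere (0 : V3) 1, (∫ w : V3, max ⟪v - w, (ω : V3)⟫_ℝ 0 * Y₀ (xs ω) *
        (ρ₀ (ys ω) * localMaxwellian 1 (θ₀ (ys ω)) (u₀ (ys ω)) w) *
        (φ x (v - ⟪v - w, (ω : V3)⟫_ℝ • (ω : V3)) + φ (ys ω) (w + ⟪v - w, (ω : V3)⟫_ℝ • (ω : V3)) -
          φ x v - φ (ys ω) w)) =
      (∫ w : V3, max ⟪v - w, (ω : V3)⟫_ℝ 0 * Y₀ (xs ω) *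
        (ρ₀ (ys ω) * localMaxwellian 1 (θ₀ (ys ω)) (u₀ (ys ω)) w) *
        (φ₁ x (v - ⟪v - w, (ω : V3)⟫_ℝ • (ω : V3)) + φ₁ (ys ω) (w + ⟪v - w, (ω : V3)⟫_ℝ • (ω : V3)) -
          φ₁ x v - φ₁ (ys ω) w)) +
      b * ∫ w : V3, max ⟪v - w, (ω : V3)⟫_ℝ 0 * Y₀ (xs ω) *
        (ρ₀ (ys ω) * localMaxwellian 1 (θ₀ (ys ω)) (u₀ (ys ω)) w) *
        (φ₂ x (v - ⟪v - w, (ω : V3)⟫_ℝ • (ω : V3)) + φ₂ (ys ω) (w + ⟪v - w, (ω : V3)⟫_ℝ • (ω : V3)) -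
          φ₂ x v - φ₂ (ys ω) w) := by
    intro ω
    have hI₁ := (k2r_bracket_inner hρb hθb hub hYb h1c hφ₁b hCG (xs ω) (ys ω) x v ω).1
    have hI₂ := ((k2r_bracket_inner hρb hθb hub hYb h2c hφ₂b hCG (xs ω) (ys ω) x v ω).1).const_mul b
    rw [← integral_const_mul, ← integral_add hI₁ hI₂]
    refine integral_congr_ae (Eventually.of_forall fun w => ?_)
    simp only [hφ]
    ring
  have hO₁ := k2r_bracket_outer hρc hθc huc hYc hρb hθb hub hYb hφ₁c hφ₁b hCG hxs hys x v
  have hO₂ := (k2r_bracket_outer hρc hθc huc hYc hρb hθb hub hYb hφ₂c hφ₂b hCG hxs hys x v).const_mul b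
  rw [← integral_const_mul, ← integral_add hO₁ hO₂]
  exact integral_congr_ae (Eventually.of_forall hinner)

end Bracket

/-! ## Along a time window: measurability after freezing time, and the split `L[φ] = L[ψ] + L̃[κ]` -/

section Window

variable {t : ℝ} {Yf g θf : ℝ → T3 → ℝ} {uf : ℝ → T3 → V3} {xs ys : T3 → sphere (0 : V3) 1 → T3}

/-- **Measurability of the time-frozen test-side operator.** If the profiles `Y, ρ, θ > 0, u` are
jointly continuous on `[0, t] × 𝕋³`, the test function `χ` is jointly continuous and the shifts
`x_ω, y_ω` are continuous, then `(s, x, v) ↦ L[χ](πs, x, v)` (`π` the projection onto `[0, t]`) is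
measurable (`measurable_enskogL_of_continuous` on the frozen profiles). [folklore] -/
theorem k2r_measurable_enskogL_frozen (ht : 0 ≤ t)
    (hYc : ContinuousOn (fun p : ℝ × T3 => Yf p.1 p.2) (Icc 0 t ×ˢ univ))
    (hgc : ContinuousOn (uncurry g) (Icc 0 t ×ˢ univ)) (hθc : ContinuousOn (uncurry θf) (Icc 0 t ×ˢ univ))
    (hθpos : ∀ s ∈ Icc 0 t, ∀ x, 0 < θf s x) (huc : ContinuousOn (uncurry uf) (Icc 0 t ×ˢ univ))
    (hxs : Continuous (uncurry xs)) (hys : Continuous (uncurry ys)) {χ : ℝ → T3 → V3 → ℝ}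
    (hχc : Continuous fun p : ℝ × T3 × V3 => χ p.1 p.2.1 p.2.2) {lam : ℝ} (L : ℝ → T3 → V3 → ℝ)
    (hL : ∀ s x v, L s x v = lam * ∫ ω : sphere (0 : V3) 1, (∫ w : V3,
      max ⟪v - w, (ω : V3)⟫_ℝ 0 * Yf s (xs x ω) *
        (g s (ys x ω) * localMaxwellian 1 (θf s (ys x ω)) (uf s (ys x ω)) w) *
        (χ s x (v - ⟪v - w, (ω : V3)⟫_ℝ • (ω : V3)) + χ s (ys x ω) (w + ⟪v - w, (ω : V3)⟫_ℝ • (ω : V3)) -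
          χ s x v - χ s (ys x ω) w)) ∂sphereMeasure) :
    Measurable fun p : ℝ × T3 × V3 => L (max 0 (min t p.1)) p.2.1 p.2.2 := by
  have hπm : ∀ s, max 0 (min t s) ∈ Icc 0 t := clamp_mem_Icc ht
  have hπc : Continuous fun s : ℝ => max 0 (min t s) :=
    continuous_const.max (continuous_const.min continuous_id)
  exact measurable_enskogL_of_continuous
    (Yf := fun s => Yf (max 0 (min t s))) (g := fun s => g (max 0 (min t s)))
    (θf := fun s => θf (max 0 (min t s))) (uf := fun s => uf (max 0 (min t s)))
    (φ := fun s => χ (max 0 (min t s))) (xs := xs) (ys := ys) (lam := lam)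
    (continuous_frozen ht hYc) (continuous_frozen ht hgc) (continuous_frozen ht hθc)
    (fun s x => hθpos _ (hπm s) x) (continuous_frozen ht huc)
    (hχc.comp ((hπc.comp continuous_fst).prodMk continuous_snd)) hxs hys
    (fun s => L (max 0 (min t s))) (fun s x v => hL _ x v)

/-- **The split `L[φ] = L[ψ] + L̃[κ]` on the window.** For profiles jointly continuous and bounded on
`[0, t] × 𝕋³` (`0 ≤ ρ ≤ R`, `0 < θ ≤ Θ`, `‖u‖ ≤ U`, `|Y| ≤ Ȳ`), continuous shifts, jointly continuous
`ψ, κ` of quadratic growth and `φ = ψ + λ⁻¹κ` with `λ ≠ 0`: the operators `L = λE[φ]`, `L_ψ = λE[ψ]`,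
`L_κ = E[κ]` satisfy `L = L_ψ + L_κ` on `[0, t] × 𝕋³ × ℝ³` (`k2r_bracket_linear`). [folklore] -/
theorem k2r_enskogL_split {R Θ U Ybar : ℝ}
    (hYc : ContinuousOn (fun p : ℝ × T3 => Yf p.1 p.2) (Icc 0 t ×ˢ univ))
    (hgc : ContinuousOn (uncurry g) (Icc 0 t ×ˢ univ)) (hθc : ContinuousOn (uncurry θf) (Icc 0 t ×ˢ univ))
    (huc : ContinuousOn (uncurry uf) (Icc 0 t ×ˢ univ)) (hYb : ∀ s ∈ Icc 0 t, ∀ x, |Yf s x| ≤ Ybar)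
    (hgb : ∀ s ∈ Icc 0 t, ∀ x, 0 ≤ g s x ∧ g s x ≤ R) (hub : ∀ s ∈ Icc 0 t, ∀ x, ‖uf s x‖ ≤ U)
    (hθb : ∀ s ∈ Icc 0 t, ∀ x, 0 < θf s x ∧ θf s x ≤ Θ)
    (hxs : Continuous (uncurry xs)) (hys : Continuous (uncurry ys))
    {φ ψ κ : ℝ → T3 → V3 → ℝ} {lam Cψ Cκ : ℝ} (hlam : lam ≠ 0)
    (hφ : ∀ s x v, φ s x v = ψ s x v + lam⁻¹ * κ s x v)
    (hψc : Continuous fun p : ℝ × T3 × V3 => ψ p.1 p.2.1 p.2.2)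
    (hκc : Continuous fun p : ℝ × T3 × V3 => κ p.1 p.2.1 p.2.2)
    (hψb : ∀ s x v, |ψ s x v| ≤ Cψ * (1 + ‖v‖ ^ 2)) (hκb : ∀ s x v, |κ s x v| ≤ Cκ * (1 + ‖v‖ ^ 2))
    (L Lψ Lκ : ℝ → T3 → V3 → ℝ)
    (hL : ∀ s x v, L s x v = lam * ∫ ω : sphere (0 : V3) 1, (∫ w : V3,
      max ⟪v - w, (ω : V3)⟫_ℝ 0 * Yf s (xs x ω) *
        (g s (ys x ω) * localMaxwellian 1 (θf s (ys x ω)) (uf s (ys x ω)) w) *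
        (φ s x (v - ⟪v - w, (ω : V3)⟫_ℝ • (ω : V3)) + φ s (ys x ω) (w + ⟪v - w, (ω : V3)⟫_ℝ • (ω : V3)) -
          φ s x v - φ s (ys x ω) w)) ∂sphereMeasure)
    (hLψ : ∀ s x v, Lψ s x v = lam * ∫ ω : sphere (0 : V3) 1, (∫ w : V3,
      max ⟪v - w, (ω : V3)⟫_ℝ 0 * Yf s (xs x ω) *
        (g s (ys x ω) * localMaxwellian 1 (θf s (ys x ω)) (uf s (ys x ω)) w) *
        (ψ s x (v - ⟪v - w, (ω : V3)⟫_ℝ • (ω : V3)) + ψ s (ys x ω) (w + ⟪v - w, (ω : V3)⟫_ℝ • (ω : V3)) -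
          ψ s x v - ψ s (ys x ω) w)) ∂sphereMeasure)
    (hLκ : ∀ s x v, Lκ s x v = ∫ ω : sphere (0 : V3) 1, (∫ w : V3,
      max ⟪v - w, (ω : V3)⟫_ℝ 0 * Yf s (xs x ω) *
        (g s (ys x ω) * localMaxwellian 1 (θf s (ys x ω)) (uf s (ys x ω)) w) *
        (κ s x (v - ⟪v - w, (ω : V3)⟫_ℝ • (ω : V3)) + κ s (ys x ω) (w + ⟪v - w, (ω : V3)⟫_ℝ • (ω : V3)) -
          κ s x v - κ s (ys x ω) w)) ∂sphereMeasure) :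
    ∀ s ∈ Icc 0 t, ∀ x v, L s x v = Lψ s x v + Lκ s x v := by
  obtain ⟨CG, -, hCG⟩ := exists_integral_one_add_norm_sq_sq_gaussMeasure_le U Θ
  intro s hs x v
  have hgs : Continuous (g s) :=
    hgc.comp_continuous (continuous_const.prodMk continuous_id) fun y => ⟨hs, mem_univ y⟩
  have hθs : Continuous (θf s) :=
    hθc.comp_continuous (continuous_const.prodMk continuous_id) fun y => ⟨hs, mem_univ y⟩
  have hus : Continuous (uf s) :=
    huc.comp_continuous (continuous_const.prodMk continuous_id) fun y => ⟨hs, mem_univ y⟩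
  have hYs : Continuous (Yf s) :=
    hYc.comp_continuous (continuous_const.prodMk continuous_id) fun y => ⟨hs, mem_univ y⟩
  have hψs : Continuous (uncurry (ψ s)) := hψc.comp (continuous_const.prodMk continuous_id)
  have hκs : Continuous (uncurry (κ s)) := hκc.comp (continuous_const.prodMk continuous_id)
  have hxs' : Continuous (xs x) := hxs.comp (Continuous.prodMk_right x)
  have hys' : Continuous (ys x) := hys.comp (Continuous.prodMk_right x)
  have hlin := k2r_bracket_linear (ρ₀ := g s) (θ₀ := θf s) (u₀ := uf s) (Y₀ := Yf s) hgs hθs hus hYs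
    (fun y => hgb s hs y) (fun y => hθb s hs y) (fun y => hub s hs y) (fun y => hYb s hs y) hCG
    hxs' hys' (φ := φ s) (φ₁ := ψ s) (φ₂ := κ s) (b := lam⁻¹) (fun y w => hφ s y w) hψs hκs
    (fun y w => hψb s y w) (fun y w => hκb s y w) x v
  rw [hL, hLψ, hLκ, hlin, mul_add, ← mul_assoc, mul_inv_cancel₀ hlam, one_mul]

end Window

/-! ## Registered sub-goal of stub `stub_defectSplit` proved in this file -/

/-- **Registered sub-goal `stub_defectSplit_bracket`** (K2R line `birth`, stub G1, part 2): the split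
`L[φ] = L[ψ] + L̃[κ]` on the window (`k2r_enskogL_split`), as a closed statement. [folklore] -/
theorem stub_defectSplit_bracket :
    ∀ (t : ℝ) (Yf g θf : ℝ → UnitAddTorus (Fin 3) → ℝ) (uf : ℝ → UnitAddTorus (Fin 3) → EuclideanSpace ℝ
      (Fin 3)) (xs ys : UnitAddTorus (Fin 3) → Metric.sphere (0 : EuclideanSpace ℝ (Fin 3)) 1 → UnitAddTorus
      (Fin 3)) (R Θ U Ybar : ℝ), ContinuousOn (fun p : ℝ × UnitAddTorus (Fin 3) => Yf p.1 p.2) (Set.Icc 0 t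
      ×ˢ Set.univ) → ContinuousOn (Function.uncurry g) (Set.Icc 0 t ×ˢ Set.univ) → ContinuousOn
      (Function.uncurry θf) (Set.Icc 0 t ×ˢ Set.univ) → ContinuousOn (Function.uncurry uf) (Set.Icc 0 t ×ˢ
      Set.univ) → (∀ s ∈ Set.Icc 0 t, ∀ x, |Yf s x| ≤ Ybar) → (∀ s ∈ Set.Icc 0 t, ∀ x, 0 ≤ g s x ∧ g s x ≤
      R) → (∀ s ∈ Set.Icc 0 t, ∀ x, ‖uf s x‖ ≤ U) → (∀ s ∈ Set.Icc 0 t, ∀ x, 0 < θf s x ∧ θf s x ≤ Θ) →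
      Continuous (Function.uncurry xs) → Continuous (Function.uncurry ys) → ∀ (φ ψ κ : ℝ → UnitAddTorus (Fin
      3) → EuclideanSpace ℝ (Fin 3) → ℝ) (lam Cψ Cκ : ℝ), lam ≠ 0 → (∀ s x v, φ s x v = ψ s x v + lam⁻¹ * κ
      s x v) → Continuous (fun p : ℝ × UnitAddTorus (Fin 3) × EuclideanSpace ℝ (Fin 3) => ψ p.1 p.2.1 p.2.2)
      → Continuous (fun p : ℝ × UnitAddTorus (Fin 3) × EuclideanSpace ℝ (Fin 3) => κ p.1 p.2.1 p.2.2) → (∀ s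
      x v, |ψ s x v| ≤ Cψ * (1 + ‖v‖ ^ 2)) → (∀ s x v, |κ s x v| ≤ Cκ * (1 + ‖v‖ ^ 2)) → ∀ (L Lψ Lκ : ℝ →
      UnitAddTorus (Fin 3) → EuclideanSpace ℝ (Fin 3) → ℝ), (∀ s x v, L s x v = lam * ∫ ω : Metric.sphere (0
      : EuclideanSpace ℝ (Fin 3)) 1, (∫ w : EuclideanSpace ℝ (Fin 3), max (inner ℝ (v - w) ω) 0 * Yf s (xs x
      ω) * (g s (ys x ω) * Literature.Analysis.FluidPDE.localMaxwellian 1 (θf s (ys x ω)) (uf s (ys x ω)) w)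
      * (φ s x (v - inner ℝ (v - w) ω • (ω : EuclideanSpace ℝ (Fin 3))) + φ s (ys x ω) (w + inner ℝ (v - w)
      ω • (ω : EuclideanSpace ℝ (Fin 3))) - φ s x v - φ s (ys x ω) w))
      ∂Literature.MathematicalPhysics.KineticTheory.sphereMeasure) → (∀ s x v, Lψ s x v = lam * ∫ ω :
      Metric.sphere (0 : EuclideanSpace ℝ (Fin 3)) 1, (∫ w : EuclideanSpace ℝ (Fin 3), max (inner ℝ (v - w)
      ω) 0 * Yf s (xs x ω) * (g s (ys x ω) * Literature.Analysis.FluidPDE.localMaxwellian 1 (θf s (ys x ω))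
      (uf s (ys x ω)) w) * (ψ s x (v - inner ℝ (v - w) ω • (ω : EuclideanSpace ℝ (Fin 3))) + ψ s (ys x ω) (w
      + inner ℝ (v - w) ω • (ω : EuclideanSpace ℝ (Fin 3))) - ψ s x v - ψ s (ys x ω) w))
      ∂Literature.MathematicalPhysics.KineticTheory.sphereMeasure) → (∀ s x v, Lκ s x v = ∫ ω :
      Metric.sphere (0 : EuclideanSpace ℝ (Fin 3)) 1, (∫ w : EuclideanSpace ℝ (Fin 3), max (inner ℝ (v - w)
      ω) 0 * Yf s (xs x ω) * (g s (ys x ω) * Literature.Analysis.FluidPDE.localMaxwellian 1 (θf s (ys x ω))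
      (uf s (ys x ω)) w) * (κ s x (v - inner ℝ (v - w) ω • (ω : EuclideanSpace ℝ (Fin 3))) + κ s (ys x ω) (w
      + inner ℝ (v - w) ω • (ω : EuclideanSpace ℝ (Fin 3))) - κ s x v - κ s (ys x ω) w))
      ∂Literature.MathematicalPhysics.KineticTheory.sphereMeasure) → ∀ s ∈ Set.Icc 0 t, ∀ x v, L s x v = Lψ
      s x v + Lκ s x v := by
  intro t Yf g θf uf xs ys R Θ U Ybar hYc hgc hθc huc hYb hgb hub hθb hxs hys φ ψ κ lam Cψ Cκ hlam hφ
    hψc hκc hψb hκb L Lψ Lκ hL hLψ hLκ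
  exact k2r_enskogL_split hYc hgc hθc huc hYb hgb hub hθb hxs hys hlam hφ hψc hκc hψb hκb L Lψ Lκ
    hL hLψ hLκ

end Summit.AtomisticToContinuum.HydrodynamicLimit.Theorems.EnskogAdjointDuality

end
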